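import Literature.Analysis.FluidPDE.Seregin2020BlowupLimit
import Literature.Analysis.FluidPDE.LocalTypeILscVelocity
import Literature.Analysis.FluidPDE.LocalTypeILscPressure
import Literature.Analysis.FluidPDE.LocalTypeIScaling
import Literature.Analysis.FluidPDE.CKNScalingExtras
import HarnessLib

/-!
# Scale-invariant bounds of a blow-up limit at every apex, from uniform local bounds of the
# original pair (Wang–Zhang 2017, §4 Step 1, (4.3)–(4.4))

Analysis/FluidPDE proofs-only file (theorems only: no definition, no named fact; nothing accepted
is restated or changed). In the blow-up argument of W. Wang, Z. Zhang, *Blow-up of critical norms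
for the 3-D Navier–Stokes equations*, Sci. China Math. 60 (2017) = arXiv:1510.02589, §4 Step 1,
the rescaled solutions `u^k(x,t) = r_k u(r_k x, r_k² t)` inherit from Lemma 4.1 the bounds "(4.3)
`A(u^k,a,z₀) + E(u^k,a,z₀) + C(u^k,a,z₀) + D(π^k,a,z₀) ≤ C(M, C(u,1), D(π,1))` if `k` large enough"
at every apex `z₀ ∈ ℝ³ × (-T, 0)` and every radius, and "the lower semi-continuity of the norm
gives (4.4)" for the limit. This file proves that passage for the blow-up limit produced by the
tree's extraction `exists_zoom_blowup_limit` (strong `L³` convergence of the rescaled velocities,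
weak `L^{3/2}` convergence of the rescaled pressures on every `Q(a)`): if the original pair has
`C, A, D ≤ K` at all apices in a backward time window around the blow-up centre and all radii
`≤ r₁`, then the limit has `C, A, D ≤ K` at **every** apex with `t ≤ 0` and **every** radius
(`blowup_cknC_le_apex`, `blowup_cknAEss_le_apex`, `blowup_cknD_le_apex`), by the scale
covariance `C(u^k; r; z) = C(u; μ_k r; Φ_k z)` (`cknC_nsZoom`, `cknAEss_nsZoom`, `cknD_nsZoom`)
and the lower semicontinuity lemmas `cknC_le_of_tendsto_eLpNorm`, `cknAEss_le_of_tendsto_eLpNorm`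
and, for the pressure, the weak lower semicontinuity of `∫_S |·|^{3/2}` on sub-cylinders
(`setLIntegral_rpow_threeHalves_le_of_tendsto_weakly`, the argument of `blowup_cknD_le_of` with
the test function `𝟙_S π/√|π|`).

## References

* W. Wang, Z. Zhang, Sci. China Math. 60 (2017) 637–650 = arXiv:1510.02589, §4 Step 1,
  (4.3)–(4.4). [WangZhang2016]
* G. Seregin, *Lecture notes on regularity theory for the Navier–Stokes equations* (2014), §6.6
  Prop. 6.20. [Seregin2014]
* D. Albritton, T. Barker, J. Math. Fluid Mech. 21 (2019), §3 ("(3.6) follows from (3.3)").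
  [AlbrittonBarker2019]
-/

noncomputable section

open MeasureTheory Set Function Filter Topology TopologicalSpace Metric
open scoped NNReal ENNReal

namespace Literature.Analysis.FluidPDE

/-! ### Weak lower semicontinuity of `∫_S |·|^{3/2}` on subsets -/

section WeakLsc

/-- **Weak lower semicontinuity of `∫_S |p|^{3/2}` on a measurable subset.** If `P_j ⇀ π` weakly
in `L^{3/2}(Q₀)` (tested against `L³(Q₀)`), `π ∈ L^{3/2}(Q₀)`, `S ⊆ Q₀` is measurable and
`∫_S |P_j|^{3/2} ≤ N₀` eventually, then `∫_S |π|^{3/2} ≤ N₀` (test against `𝟙_S π/√|π| ∈ L³`,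
Hölder, pass to the limit; the argument of `blowup_cknD_le_of`). [cite: Seregin2014, §6.6 Prop. 6.20] -/
theorem setLIntegral_rpow_threeHalves_le_of_tendsto_weakly
    {Q₀ S : Set (ℝ × EuclideanSpace ℝ (Fin 3))} (hS : MeasurableSet S) (hSQ : S ⊆ Q₀)
    {P : ℕ → ℝ × EuclideanSpace ℝ (Fin 3) → ℝ} {π : ℝ × EuclideanSpace ℝ (Fin 3) → ℝ}
    (hπ : MemLp π (3 / 2) (volume.restrict Q₀)) {j₀ : ℕ}
    (hPm : ∀ j, j₀ ≤ j → AEStronglyMeasurable (P j) (volume.restrict Q₀)) {N₀ : ℝ≥0∞}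
    (hPk : ∀ j, j₀ ≤ j → ∫⁻ w in S, ‖P j w‖ₑ ^ (3 / 2 : ℝ) ≤ N₀)
    (hweak : ∀ g : ℝ × EuclideanSpace ℝ (Fin 3) → ℝ, MemLp g 3 (volume.restrict Q₀) →
      Tendsto (fun j => ∫ w in Q₀, P j w * g w) atTop (𝓝 (∫ w in Q₀, π w * g w))) :
    ∫⁻ w in S, ‖π w‖ₑ ^ (3 / 2 : ℝ) ≤ N₀ := by
  haveI : ENNReal.HolderTriple (3 / 2 : ℝ≥0∞) 3 1 := holderTriple_threeHalves_three_one'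
  set μ' : Measure (ℝ × EuclideanSpace ℝ (Fin 3)) := volume.restrict Q₀ with hμ'
  obtain ⟨h32, h32', h32r⟩ := threeHalves_facts
  have h320 : (3 / 2 : ℝ≥0∞) ≠ 0 := (zero_lt_one.trans_le h32).ne'
  -- the test function `g = 𝟙_S π/√|π|`
  set N : ℝ≥0∞ := ∫⁻ w in S, ‖π w‖ₑ ^ (3 / 2 : ℝ) with hN
  have hNle : N ≤ ∫⁻ w, ‖π w‖ₑ ^ (3 / 2 : ℝ) ∂μ' := lintegral_mono_set hSQ
  have hNtop : N ≠ ∞ := by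
    have h1 := hπ.eLpNorm_lt_top
    rw [eLpNorm_eq_lintegral_rpow_enorm_toReal h320 h32', h32r] at h1
    exact (hNle.trans_lt ((ENNReal.rpow_lt_top_iff_of_pos (by norm_num)).1 h1)).ne
  set g : ℝ × EuclideanSpace ℝ (Fin 3) → ℝ :=
    S.indicator fun w => π w / Real.sqrt |π w| with hgdef
  have hg0m : AEStronglyMeasurable (fun w => π w / Real.sqrt |π w|) μ' :=
    (hπ.1.aemeasurable.div
      (continuous_abs.measurable.comp_aemeasurable hπ.1.aemeasurable).sqrt).aestronglyMeasurable
  have hgm : AEStronglyMeasurable g μ' := hg0m.indicator hS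
  have hg3 : ∫⁻ w, ‖g w‖ₑ ^ (3 : ℝ) ∂μ' = N := by
    have e : ∀ w, ‖g w‖ₑ ^ (3 : ℝ) = S.indicator (fun w => ‖π w‖ₑ ^ (3 / 2 : ℝ)) w := by
      intro w
      by_cases hw : w ∈ S
      · rw [hgdef, indicator_of_mem hw, indicator_of_mem hw]
        exact enorm_div_sqrt_abs_rpow_three _
      · rw [hgdef, indicator_of_notMem hw, indicator_of_notMem hw, enorm_zero,
          ENNReal.zero_rpow_of_pos (by norm_num)]
    simp_rw [e]
    rw [lintegral_indicator hS, hμ', Measure.restrict_restrict hS, inter_eq_left.2 hSQ]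
  have hgmem : MemLp g 3 μ' := by
    refine ⟨hgm, ?_⟩
    rw [eLpNorm_eq_lintegral_rpow_enorm_toReal (by norm_num) (by norm_num), ENNReal.toReal_ofNat,
      hg3]
    exact ENNReal.rpow_lt_top_of_nonneg (by norm_num) hNtop
  -- ## Step A: `∫ π g = N`
  have hA : ENNReal.ofReal (∫ w, π w * g w ∂μ') = N := by
    have hPg : ∀ w, π w * g w = S.indicator (fun w => |π w| ^ (3 / 2 : ℝ)) w := by
      intro w
      by_cases hw : w ∈ S
      · rw [hgdef, indicator_of_mem hw, indicator_of_mem hw]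
        exact mul_div_sqrt_abs_eq_rpow (π w)
      · rw [hgdef, indicator_of_notMem hw, indicator_of_notMem hw, mul_zero]
    have hint : Integrable (fun w => π w * g w) μ' := hπ.integrable_mul hgmem
    have hnn : 0 ≤ᵐ[μ'] fun w => π w * g w :=
      Eventually.of_forall fun w => by
        simp only [Pi.zero_apply]; rw [hPg]
        by_cases hw : w ∈ S
        · rw [indicator_of_mem hw]; positivity
        · rw [indicator_of_notMem hw]
    rw [ofReal_integral_eq_lintegral_ofReal hint hnn]
    have e : ∀ w, ENNReal.ofReal (π w * g w) = S.indicator (fun w => ‖π w‖ₑ ^ (3 / 2 : ℝ)) w := by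
      intro w
      rw [hPg]
      by_cases hw : w ∈ S
      · rw [indicator_of_mem hw, indicator_of_mem hw,
          ← ENNReal.ofReal_rpow_of_nonneg (abs_nonneg _) (by norm_num), ← Real.enorm_eq_ofReal_abs]
      · rw [indicator_of_notMem hw, indicator_of_notMem hw, ENNReal.ofReal_zero]
    simp_rw [e]
    rw [lintegral_indicator hS, hμ', Measure.restrict_restrict hS, inter_eq_left.2 hSQ]
  -- ## Step B: Hölder bound on the approximants
  have hB : ∀ j, j₀ ≤ j → ‖∫ w, P j w * g w ∂μ'‖ₑ ≤ N₀ ^ (2 / 3 : ℝ) * N ^ (1 / 3 : ℝ) := by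
    intro j hj
    -- `∫ P_j g = ∫_S P_j (π/√|π|)`
    have hsupp : ∀ w, ‖P j w * g w‖ₑ = S.indicator (fun w => ‖P j w‖ₑ * ‖π w / Real.sqrt |π w|‖ₑ) w := by
      intro w
      by_cases hw : w ∈ S
      · rw [hgdef, indicator_of_mem hw, indicator_of_mem hw, enorm_mul]
      · rw [hgdef, indicator_of_notMem hw, indicator_of_notMem hw, mul_zero, enorm_zero]
    refine (enorm_integral_le_lintegral_enorm _).trans ?_
    simp_rw [hsupp]
    rw [lintegral_indicator hS, hμ', Measure.restrict_restrict hS, inter_eq_left.2 hSQ]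
    have hPm' : AEMeasurable (fun w => ‖P j w‖ₑ) (volume.restrict S) :=
      ((hPm j hj).mono_measure (Measure.restrict_mono hSQ le_rfl)).aemeasurable.enorm
    have hg0m' : AEMeasurable (fun w => ‖π w / Real.sqrt |π w|‖ₑ) (volume.restrict S) :=
      (hg0m.mono_measure (Measure.restrict_mono hSQ le_rfl)).aemeasurable.enorm
    have hH := ENNReal.lintegral_mul_le_Lp_mul_Lq (volume.restrict S)
      (Real.holderConjugate_iff.2 ⟨by norm_num, by norm_num⟩ : (3 / 2 : ℝ).HolderConjugate 3)
      hPm' hg0m'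
    simp only [Pi.mul_apply] at hH
    have hg3' : ∫⁻ w in S, ‖π w / Real.sqrt |π w|‖ₑ ^ (3 : ℝ) = N :=
      lintegral_congr fun w => enorm_div_sqrt_abs_rpow_three _
    calc ∫⁻ w in S, ‖P j w‖ₑ * ‖π w / Real.sqrt |π w|‖ₑ
        ≤ (∫⁻ w in S, ‖P j w‖ₑ ^ (3 / 2 : ℝ)) ^ (1 / (3 / 2 : ℝ)) *
            (∫⁻ w in S, ‖π w / Real.sqrt |π w|‖ₑ ^ (3 : ℝ)) ^ (1 / (3 : ℝ)) := hH
      _ ≤ N₀ ^ (2 / 3 : ℝ) * N ^ (1 / 3 : ℝ) := by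
          rw [hg3', show (1 / (3 / 2 : ℝ)) = 2 / 3 by norm_num]
          gcongr
          exact hPk j hj
  -- ## Step C–D: pass to the limit
  have hC : Tendsto (fun j => ∫ w, P j w * g w ∂μ') atTop (𝓝 (∫ w, π w * g w ∂μ')) := hweak g hgmem
  have hDlim : N ≤ N₀ ^ (2 / 3 : ℝ) * N ^ (1 / 3 : ℝ) :=
    calc N = ENNReal.ofReal (∫ w, π w * g w ∂μ') := hA.symm
      _ ≤ ‖∫ w, π w * g w ∂μ'‖ₑ := Real.ofReal_le_enorm _
      _ ≤ N₀ ^ (2 / 3 : ℝ) * N ^ (1 / 3 : ℝ) :=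
          le_of_tendsto hC.enorm (eventually_atTop.2 ⟨j₀, fun j hj => hB j hj⟩)
  -- ## Step E: `N ≤ N₀`
  rcases eq_or_ne N 0 with hN0 | hN0
  · rw [hN0]; exact zero_le
  have h1 : N ^ (2 / 3 : ℝ) ≤ N₀ ^ (2 / 3 : ℝ) := by
    have h13 : N ^ (1 / 3 : ℝ) ≠ 0 := by
      intro h0
      rcases ENNReal.rpow_eq_zero_iff.1 h0 with ⟨h00, -⟩ | ⟨-, hneg⟩
      · exact hN0 h00
      · norm_num at hneg
    have h13' : N ^ (1 / 3 : ℝ) ≠ ∞ := ENNReal.rpow_ne_top_of_nonneg (by norm_num) hNtop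
    have e : N ^ (2 / 3 : ℝ) * N ^ (1 / 3 : ℝ) = N := by
      rw [← ENNReal.rpow_add _ _ hN0 hNtop]; norm_num
    rw [← ENNReal.mul_le_mul_iff_left h13 h13', e]
    exact hDlim
  have h2 := ENNReal.rpow_le_rpow h1 (by norm_num : (0 : ℝ) ≤ 3 / 2)
  rwa [← ENNReal.rpow_mul, ← ENNReal.rpow_mul, show (2 / 3 : ℝ) * (3 / 2) = 1 by norm_num,
    ENNReal.rpow_one, ENNReal.rpow_one] at h2

end WeakLsc

/-! ### The bounds of the blow-up limit at every apex -/

section Apex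

variable {v : ℝ → EuclideanSpace ℝ (Fin 3) → EuclideanSpace ℝ (Fin 3)}
  {p : ℝ → EuclideanSpace ℝ (Fin 3) → ℝ}

/-- A backward cylinder with apex `z`, `z.1 ≤ 0`, lies in `Q(a)` for
`a = ‖z.2‖ + r + √(r² - z.1) + 1`. [folklore] -/
theorem parabolicCylinder_subset_origin {z : ℝ × EuclideanSpace ℝ (Fin 3)} (hz : z.1 ≤ 0) {r : ℝ}
    (hr : 0 < r) :
    parabolicCylinder r z ⊆ parabolicCylinder (‖z.2‖ + r + Real.sqrt (r ^ 2 - z.1) + 1)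
      (0 : ℝ × EuclideanSpace ℝ (Fin 3)) := by
  intro w hw
  rw [mem_parabolicCylinder] at hw ⊢
  set a : ℝ := ‖z.2‖ + r + Real.sqrt (r ^ 2 - z.1) + 1 with ha
  have hsq : Real.sqrt (r ^ 2 - z.1) ^ 2 = r ^ 2 - z.1 := Real.sq_sqrt (by nlinarith)
  have hs0 : 0 ≤ Real.sqrt (r ^ 2 - z.1) := Real.sqrt_nonneg _
  have ha1 : Real.sqrt (r ^ 2 - z.1) + 1 ≤ a := by rw [ha]; linarith [norm_nonneg z.2]
  refine ⟨⟨?_, ?_⟩, ?_⟩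
  · simp only [Prod.fst_zero]
    have : r ^ 2 - z.1 < a ^ 2 := by nlinarith
    linarith [hw.1.1]
  · simp only [Prod.fst_zero]; linarith [hw.1.2]
  · simp only [Prod.snd_zero, dist_zero_right]
    calc ‖w.2‖ ≤ ‖w.2 - z.2‖ + ‖z.2‖ := norm_le_norm_sub_add _ _
      _ < r + ‖z.2‖ := by rw [← dist_eq_norm]; linarith [hw.2]
      _ ≤ a := by rw [ha]; linarith

/-- **Apices and radii of the rescaled cylinders**: for `z.1 ≤ 0` and `μ → 0`, the apex
`Φ_μ(z) = (t₀ + μ² z.1, x₀ + μ z.2)` of `Q_{μr}(Φ_μ z)` lies in the window `[t₀ - τ, t₀]` and the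
radius `μ r` is at most `r₁`, for all small `μ`. [folklore] -/
theorem eventually_apex_mem_window {z : ℝ × EuclideanSpace ℝ (Fin 3)} (hz : z.1 ≤ 0) (r : ℝ) {τ r₁ : ℝ}
    (hτ : 0 < τ) (hr₁ : 0 < r₁) {μ : ℕ → ℝ}
    (hμ0 : Tendsto μ atTop (𝓝 0)) (t₀ : ℝ) (x₀ : EuclideanSpace ℝ (Fin 3)) :
    ∃ j₁ : ℕ, ∀ j, j₁ ≤ j →
      (stAffine (μ j ^ 2) (μ j) t₀ x₀ z).1 ≤ t₀ ∧ t₀ - τ ≤ (stAffine (μ j ^ 2) (μ j) t₀ x₀ z).1 ∧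
        μ j * r ≤ r₁ := by
  have h1 : ∀ᶠ j in atTop, μ j ^ 2 * (-z.1) ≤ τ := by
    have ht : Tendsto (fun j => μ j ^ 2 * (-z.1)) atTop (𝓝 (0 ^ 2 * (-z.1))) :=
      (hμ0.pow 2).mul_const _
    rw [zero_pow two_ne_zero, zero_mul] at ht
    exact ht.eventually (ge_mem_nhds hτ)
  have h2 : ∀ᶠ j in atTop, μ j * r ≤ r₁ := by
    have ht : Tendsto (fun j => μ j * r) atTop (𝓝 (0 * r)) := hμ0.mul_const r
    rw [zero_mul] at ht
    exact ht.eventually (ge_mem_nhds hr₁)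
  obtain ⟨j₁, hj₁⟩ := (h1.and h2).exists_forall_of_atTop
  refine ⟨j₁, fun j hj => ?_⟩
  obtain ⟨ha, hb⟩ := hj₁ j hj
  rw [stAffine_fst]
  refine ⟨?_, ?_, hb⟩
  · have : μ j ^ 2 * z.1 ≤ 0 := mul_nonpos_of_nonneg_of_nonpos (sq_nonneg _) hz
    linarith
  · nlinarith

/-- **`C` of the blow-up limit at every apex** (Wang–Zhang 2017, §4 Step 1, (4.3)–(4.4) for
`C`). In the setting of `exists_zoom_blowup_limit` (strong `L³(Q(a))` convergence of the rescaled
velocities `u^{μ_j} = μ_j v(t₀ + μ_j²·, x₀ + μ_j·)`, `μ_j = 2^{-(δ(j)+2)}`, to `w`, for every `a`),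
if `C(r; z) ≤ K` for the original field at every apex `z` in the window `t₀ - τ ≤ z.1 ≤ t₀` and
every `0 < r ≤ r₁`, then `C(r; z)[w] ≤ K` at every apex with `z.1 ≤ 0` and every `r > 0`.
[cite: WangZhang2016, §4 Step 1 (4.3)–(4.4)] -/
theorem blowup_cknC_le_apex {z₀ : ℝ × EuclideanSpace ℝ (Fin 3)}
    (hvm : AEStronglyMeasurable (uncurry v) (volume.restrict (parabolicCylinder (1 / 2) z₀)))
    {K : ℝ≥0} {τ r₁ : ℝ} (hτ : 0 < τ) (hr₁ : 0 < r₁)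
    (hK : ∀ z : ℝ × EuclideanSpace ℝ (Fin 3), z.1 ≤ z₀.1 → z₀.1 - τ ≤ z.1 →
      ∀ r ∈ Ioc (0 : ℝ) r₁, cknC r z v ≤ K)
    {δ : ℕ → ℕ} (hδge : ∀ k, k ≤ δ k)
    {w : ℝ → EuclideanSpace ℝ (Fin 3) → EuclideanSpace ℝ (Fin 3)}
    (hwm : ∀ a : ℝ, 0 < a → MemLp (uncurry w) 3
      (volume.restrict (parabolicCylinder a (0 : ℝ × EuclideanSpace ℝ (Fin 3)))))
    (hconv : ∀ a : ℝ, 0 < a → Tendsto (fun j => eLpNorm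
        (uncurry (((1 / 2 : ℝ) ^ (δ j + 2)) •
            stPull (((1 / 2 : ℝ) ^ (δ j + 2)) ^ 2) ((1 / 2 : ℝ) ^ (δ j + 2)) z₀.1 z₀.2 v) -
          uncurry w) 3
        (volume.restrict (parabolicCylinder a (0 : ℝ × EuclideanSpace ℝ (Fin 3)))))
      atTop (𝓝 0))
    {z : ℝ × EuclideanSpace ℝ (Fin 3)} (hz : z.1 ≤ 0) {r : ℝ} (hr : 0 < r) :
    cknC r z w ≤ K := by
  -- the cylinder `Q(a)` containing `Q_r(z)`
  set a : ℝ := ‖z.2‖ + r + Real.sqrt (r ^ 2 - z.1) + 1 with ha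
  have hapos : 0 < a := by rw [ha]; positivity
  have hsub : parabolicCylinder r z ⊆ parabolicCylinder a (0 : ℝ × EuclideanSpace ℝ (Fin 3)) :=
    parabolicCylinder_subset_origin hz hr
  -- the scales
  set μ : ℕ → ℝ := fun j => (1 / 2 : ℝ) ^ (δ j + 2) with hμdef
  have hμpos : ∀ j, 0 < μ j := fun j => by positivity
  have hμ0 : Tendsto μ atTop (𝓝 0) := by
    have h1 : Tendsto (fun j : ℕ => (1 / 2 : ℝ) ^ (j + 2)) atTop (𝓝 0) :=
      (tendsto_pow_atTop_nhds_zero_of_lt_one (by norm_num) (by norm_num)).comp (tendsto_add_atTop_nat 2)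
    refine tendsto_of_tendsto_of_tendsto_of_le_of_le tendsto_const_nhds h1 (fun j => (hμpos j).le) fun j => ?_
    exact pow_le_pow_of_le_one (by norm_num) (by norm_num) (by have := hδge j; omega)
  obtain ⟨j₀, hj₀⟩ := eventually_scale_mul_le_half hδge hapos
  obtain ⟨j₁, hj₁⟩ := eventually_apex_mem_window hz r hτ hr₁ hμ0 z₀.1 z₀.2
  set j₂ : ℕ := max j₀ j₁ with hj₂
  set U : ℕ → ℝ → EuclideanSpace ℝ (Fin 3) → EuclideanSpace ℝ (Fin 3) :=
    fun j => (μ (j + j₂)) • stPull ((μ (j + j₂)) ^ 2) (μ (j + j₂)) z₀.1 z₀.2 v with hU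
  -- the bound for the approximants
  have hbound : ∀ j, cknC r z (U j) ≤ K := by
    intro j
    have hj : j₁ ≤ j + j₂ := le_trans (le_max_right _ _) (Nat.le_add_left _ _)
    obtain ⟨h1, h2, h3⟩ := hj₁ (j + j₂) hj
    rw [hU]
    dsimp only
    rw [cknC_nsZoom (hμpos _) hr z₀.1 z₀.2 z v]
    exact hK _ h1 h2 _ ⟨mul_pos (hμpos _) hr, h3⟩
  -- measurability and convergence on `Q(a)`
  have hUm : ∀ j, AEStronglyMeasurable (uncurry (U j))
      (volume.restrict (parabolicCylinder a (0 : ℝ × EuclideanSpace ℝ (Fin 3)))) := fun j =>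
    aestronglyMeasurable_uncurry_zoom_of hvm (hμpos _) hapos
      (hj₀ _ (le_trans (le_max_left _ _) (Nat.le_add_left _ _)))
  have hconv' : Tendsto (fun j => eLpNorm (uncurry (U j) - uncurry w) 3
      (volume.restrict (parabolicCylinder a (0 : ℝ × EuclideanSpace ℝ (Fin 3))))) atTop (𝓝 0) := by
    rw [hU]
    exact (tendsto_add_atTop_iff_nat (f := fun j => eLpNorm
      (uncurry ((μ j) • stPull ((μ j) ^ 2) (μ j) z₀.1 z₀.2 v) - uncurry w) 3
        (volume.restrict (parabolicCylinder a (0 : ℝ × EuclideanSpace ℝ (Fin 3))))) j₂).2 (hconv a hapos)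
  exact cknC_le_of_tendsto_eLpNorm hr hsub hUm (hwm a hapos).aestronglyMeasurable hconv' hbound

/-- **`A` of the blow-up limit at every apex** (essential-supremum form; Wang–Zhang 2017, §4
Step 1, (4.3)–(4.4) for `A`), same setting as `blowup_cknC_le_apex`. [cite: WangZhang2016, §4 Step 1 (4.3)–(4.4)] -/
theorem blowup_cknAEss_le_apex {z₀ : ℝ × EuclideanSpace ℝ (Fin 3)}
    (hvm : AEStronglyMeasurable (uncurry v) (volume.restrict (parabolicCylinder (1 / 2) z₀)))
    {K : ℝ≥0} {τ r₁ : ℝ} (hτ : 0 < τ) (hr₁ : 0 < r₁)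
    (hK : ∀ z : ℝ × EuclideanSpace ℝ (Fin 3), z.1 ≤ z₀.1 → z₀.1 - τ ≤ z.1 →
      ∀ r ∈ Ioc (0 : ℝ) r₁, cknAEss r z v ≤ K)
    {δ : ℕ → ℕ} (hδge : ∀ k, k ≤ δ k)
    {w : ℝ → EuclideanSpace ℝ (Fin 3) → EuclideanSpace ℝ (Fin 3)}
    (hwm : ∀ a : ℝ, 0 < a → MemLp (uncurry w) 3
      (volume.restrict (parabolicCylinder a (0 : ℝ × EuclideanSpace ℝ (Fin 3)))))
    (hconv : ∀ a : ℝ, 0 < a → Tendsto (fun j => eLpNorm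
        (uncurry (((1 / 2 : ℝ) ^ (δ j + 2)) •
            stPull (((1 / 2 : ℝ) ^ (δ j + 2)) ^ 2) ((1 / 2 : ℝ) ^ (δ j + 2)) z₀.1 z₀.2 v) -
          uncurry w) 3
        (volume.restrict (parabolicCylinder a (0 : ℝ × EuclideanSpace ℝ (Fin 3)))))
      atTop (𝓝 0))
    {z : ℝ × EuclideanSpace ℝ (Fin 3)} (hz : z.1 ≤ 0) {r : ℝ} (hr : 0 < r) :
    cknAEss r z w ≤ K := by
  set a : ℝ := ‖z.2‖ + r + Real.sqrt (r ^ 2 - z.1) + 1 with ha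
  have hapos : 0 < a := by rw [ha]; positivity
  have hsub : parabolicCylinder r z ⊆ parabolicCylinder a (0 : ℝ × EuclideanSpace ℝ (Fin 3)) :=
    parabolicCylinder_subset_origin hz hr
  set μ : ℕ → ℝ := fun j => (1 / 2 : ℝ) ^ (δ j + 2) with hμdef
  have hμpos : ∀ j, 0 < μ j := fun j => by positivity
  have hμ0 : Tendsto μ atTop (𝓝 0) := by
    have h1 : Tendsto (fun j : ℕ => (1 / 2 : ℝ) ^ (j + 2)) atTop (𝓝 0) :=
      (tendsto_pow_atTop_nhds_zero_of_lt_one (by norm_num) (by norm_num)).comp (tendsto_add_atTop_nat 2)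
    refine tendsto_of_tendsto_of_tendsto_of_le_of_le tendsto_const_nhds h1 (fun j => (hμpos j).le) fun j => ?_
    exact pow_le_pow_of_le_one (by norm_num) (by norm_num) (by have := hδge j; omega)
  obtain ⟨j₀, hj₀⟩ := eventually_scale_mul_le_half hδge hapos
  obtain ⟨j₁, hj₁⟩ := eventually_apex_mem_window hz r hτ hr₁ hμ0 z₀.1 z₀.2
  set j₂ : ℕ := max j₀ j₁ with hj₂
  set U : ℕ → ℝ → EuclideanSpace ℝ (Fin 3) → EuclideanSpace ℝ (Fin 3) :=
    fun j => (μ (j + j₂)) • stPull ((μ (j + j₂)) ^ 2) (μ (j + j₂)) z₀.1 z₀.2 v with hU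
  have hbound : ∀ j, cknAEss r z (U j) ≤ K := by
    intro j
    have hj : j₁ ≤ j + j₂ := le_trans (le_max_right _ _) (Nat.le_add_left _ _)
    obtain ⟨h1, h2, h3⟩ := hj₁ (j + j₂) hj
    rw [hU]
    dsimp only
    rw [cknAEss_nsZoom (hμpos _) hr z₀.1 z₀.2 z v]
    exact hK _ h1 h2 _ ⟨mul_pos (hμpos _) hr, h3⟩
  have hUm : ∀ j, AEStronglyMeasurable (uncurry (U j))
      (volume.restrict (parabolicCylinder a (0 : ℝ × EuclideanSpace ℝ (Fin 3)))) := fun j =>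
    aestronglyMeasurable_uncurry_zoom_of hvm (hμpos _) hapos
      (hj₀ _ (le_trans (le_max_left _ _) (Nat.le_add_left _ _)))
  have hconv' : Tendsto (fun j => eLpNorm (uncurry (U j) - uncurry w) 3
      (volume.restrict (parabolicCylinder a (0 : ℝ × EuclideanSpace ℝ (Fin 3))))) atTop (𝓝 0) := by
    rw [hU]
    exact (tendsto_add_atTop_iff_nat (f := fun j => eLpNorm
      (uncurry ((μ j) • stPull ((μ j) ^ 2) (μ j) z₀.1 z₀.2 v) - uncurry w) 3
        (volume.restrict (parabolicCylinder a (0 : ℝ × EuclideanSpace ℝ (Fin 3))))) j₂).2 (hconv a hapos)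
  exact cknAEss_le_of_tendsto_eLpNorm hr hsub hUm (hwm a hapos).aestronglyMeasurable hconv' hbound

/-- **`D` of the blow-up limit at every apex** (Wang–Zhang 2017, §4 Step 1, (4.3)–(4.4) for `D`;
weak lower semicontinuity of `∫_{Q_r(z)} |·|^{3/2}`): in the setting of
`exists_zoom_blowup_limit` (weak `L^{3/2}(Q(a))` convergence of the rescaled pressures to
`π ∈ L^{3/2}(Q(a))`, for every `a`), if `D(r; z) ≤ K` for the original pressure at every apex in
the window and every `0 < r ≤ r₁`, then `D(r; z)[π] ≤ K` at every apex with `z.1 ≤ 0` and every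
`r > 0`. [cite: WangZhang2016, §4 Step 1 (4.3)–(4.4)] -/
theorem blowup_cknD_le_apex {z₀ : ℝ × EuclideanSpace ℝ (Fin 3)}
    (hpm : AEStronglyMeasurable (uncurry p) (volume.restrict (parabolicCylinder (1 / 2) z₀)))
    {K : ℝ≥0} {τ r₁ : ℝ} (hτ : 0 < τ) (hr₁ : 0 < r₁)
    (hK : ∀ z : ℝ × EuclideanSpace ℝ (Fin 3), z.1 ≤ z₀.1 → z₀.1 - τ ≤ z.1 →
      ∀ r ∈ Ioc (0 : ℝ) r₁, cknD r z p ≤ K)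
    {δ : ℕ → ℕ} (hδge : ∀ k, k ≤ δ k) {π : ℝ → EuclideanSpace ℝ (Fin 3) → ℝ}
    (hπ : ∀ a : ℝ, 0 < a → MemLp (uncurry π) (3 / 2)
      (volume.restrict (parabolicCylinder a (0 : ℝ × EuclideanSpace ℝ (Fin 3)))))
    (hweak : ∀ a : ℝ, 0 < a → ∀ g : ℝ × EuclideanSpace ℝ (Fin 3) → ℝ,
      MemLp g 3 (volume.restrict (parabolicCylinder a (0 : ℝ × EuclideanSpace ℝ (Fin 3)))) →
      Tendsto (fun j => ∫ w' in parabolicCylinder a (0 : ℝ × EuclideanSpace ℝ (Fin 3)),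
          ((((1 / 2 : ℝ) ^ (δ j + 2)) ^ 2) •
            stPull (((1 / 2 : ℝ) ^ (δ j + 2)) ^ 2) ((1 / 2 : ℝ) ^ (δ j + 2)) z₀.1 z₀.2 p)
              w'.1 w'.2 * g w')
        atTop (𝓝 (∫ w' in parabolicCylinder a (0 : ℝ × EuclideanSpace ℝ (Fin 3)),
          π w'.1 w'.2 * g w')))
    {z : ℝ × EuclideanSpace ℝ (Fin 3)} (hz : z.1 ≤ 0) {r : ℝ} (hr : 0 < r) :
    cknD r z π ≤ K := by
  set a : ℝ := ‖z.2‖ + r + Real.sqrt (r ^ 2 - z.1) + 1 with ha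
  have hapos : 0 < a := by rw [ha]; positivity
  have hsub : parabolicCylinder r z ⊆ parabolicCylinder a (0 : ℝ × EuclideanSpace ℝ (Fin 3)) :=
    parabolicCylinder_subset_origin hz hr
  set μ : ℕ → ℝ := fun j => (1 / 2 : ℝ) ^ (δ j + 2) with hμdef
  have hμpos : ∀ j, 0 < μ j := fun j => by positivity
  have hμ0 : Tendsto μ atTop (𝓝 0) := by
    have h1 : Tendsto (fun j : ℕ => (1 / 2 : ℝ) ^ (j + 2)) atTop (𝓝 0) :=
      (tendsto_pow_atTop_nhds_zero_of_lt_one (by norm_num) (by norm_num)).comp (tendsto_add_atTop_nat 2)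
    refine tendsto_of_tendsto_of_tendsto_of_le_of_le tendsto_const_nhds h1 (fun j => (hμpos j).le) fun j => ?_
    exact pow_le_pow_of_le_one (by norm_num) (by norm_num) (by have := hδge j; omega)
  obtain ⟨j₀, hj₀⟩ := eventually_scale_mul_le_half hδge hapos
  obtain ⟨j₁, hj₁⟩ := eventually_apex_mem_window hz r hτ hr₁ hμ0 z₀.1 z₀.2
  set P : ℕ → ℝ × EuclideanSpace ℝ (Fin 3) → ℝ := fun j =>
    uncurry ((μ j) ^ 2 • stPull ((μ j) ^ 2) (μ j) z₀.1 z₀.2 p) with hP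
  have hr2 : (ENNReal.ofReal r ^ 2) ≠ 0 := pow_ne_zero _ ((ENNReal.ofReal_pos.2 hr).ne')
  have hr2' : (ENNReal.ofReal r ^ 2) ≠ ∞ := ENNReal.pow_ne_top ENNReal.ofReal_ne_top
  -- the bound for the approximants on `Q_r(z)`
  have hPk : ∀ j, max j₀ j₁ ≤ j → ∫⁻ w' in parabolicCylinder r z, ‖P j w'‖ₑ ^ (3 / 2 : ℝ) ≤
      ENNReal.ofReal r ^ 2 * K := by
    intro j hj
    obtain ⟨h1, h2, h3⟩ := hj₁ j (le_trans (le_max_right _ _) hj)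
    have hD : cknD r z ((μ j) ^ 2 • stPull ((μ j) ^ 2) (μ j) z₀.1 z₀.2 p) ≤ K := by
      rw [cknD_nsZoom (hμpos _) hr z₀.1 z₀.2 z p]
      exact hK _ h1 h2 _ ⟨mul_pos (hμpos _) hr, h3⟩
    rw [cknD] at hD
    have e : ∫⁻ w' in parabolicCylinder r z, ‖P j w'‖ₑ ^ (3 / 2 : ℝ) =
        ∫⁻ q in parabolicCylinder r z,
          ‖((μ j) ^ 2 • stPull ((μ j) ^ 2) (μ j) z₀.1 z₀.2 p) q.1 q.2‖ₑ ^ (3 / 2 : ℝ) := rfl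
    rw [e]
    exact (ENNReal.inv_mul_le_iff hr2 hr2').1 hD
  have hPm : ∀ j, max j₀ j₁ ≤ j → AEStronglyMeasurable (P j)
      (volume.restrict (parabolicCylinder a (0 : ℝ × EuclideanSpace ℝ (Fin 3)))) := fun j hj =>
    aestronglyMeasurable_uncurry_zoom_pressure_of hpm (hμpos _) hapos
      (hj₀ _ (le_trans (le_max_left _ _) hj))
  have hweak' : ∀ g : ℝ × EuclideanSpace ℝ (Fin 3) → ℝ,
      MemLp g 3 (volume.restrict (parabolicCylinder a (0 : ℝ × EuclideanSpace ℝ (Fin 3)))) →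
      Tendsto (fun j => ∫ w' in parabolicCylinder a (0 : ℝ × EuclideanSpace ℝ (Fin 3)), P j w' * g w')
        atTop (𝓝 (∫ w' in parabolicCylinder a (0 : ℝ × EuclideanSpace ℝ (Fin 3)), uncurry π w' * g w')) :=
    fun g hg => hweak a hapos g hg
  have h := setLIntegral_rpow_threeHalves_le_of_tendsto_weakly (isOpen_parabolicCylinder r z).measurableSet
    hsub (hπ a hapos) hPm hPk hweak'
  rw [cknD]
  exact (ENNReal.inv_mul_le_iff hr2 hr2').2 h

end Apex

end Literature.Analysis.FluidPDE

end
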